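import Summits.BirchSwinnertonDyer.BirchSwinnertonDyer.Theorems.GenusKolyvaginAtTwoPowDvdShaCardAtTwoRTLagrangianReduction
import HarnessLib

/-!
# Route `GenusKolyvaginAtTwo`, crux L_T `PowDvdShaCardAtTwoRT` (stmt-BirchSwinnertonDyer-23242), LINE 18 stub L
# (`stub_twinShaLaddersAtTwo`), bottom rung: THE RELAXED LAGRANGIAN COUNT AS AN EQUALITY and the TWO-LEVEL ORDER LEMMA

LEAD seat `bsd-line-gk2-p1` g16 (cell `bsd-f1-sign2`), `--supports 23242 --as helper`.  Finite-group algebra only (X11b's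
`FiniteDuality` annihilator API, gk2-p4's sum pairing, gk2-p3's Lagrangian reduction); THEOREMS ONLY, no `sorry`.  BSD is NOT
proved by any of this; neither is the crux nor stub L.

WHY (memo `Cruxes/PowDvdShaCardAtTwoRT/Lines/plus-descent-lead-g16.md` §2, §6).  The bottom rung of the 3a⁗ swap oracle (raise a
2-primitive Kolyvagin witness to deep primes) runs, for witnesses of index `≥ 2`, on the level-`4` ℚ-side engine `X := 2·desc c₂(nℓ′)`
provided an AUXILIARY class of ORDER `4` exists in the solution group
`𝒴₄ = {y : Kummer off n, free at the k ≥ 1 non-deep own primes, a prescribed condition at the deep own primes}`.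
gk2-p4's counting form of McCallum's Prop. 2.1 (`sq_natCard_solutions_ge`: `∏_{free} #H¹ ≤ #𝒴²`) is an INEQUALITY and cannot see the
order of an element when the `2`-torsion of `𝒴₄` is large.  The EXACT count is Wiles' formula in Lagrangian form: if `G ≤ V` is
Lagrangian (`{}^⊥G = G`, the image of the global classes, gk2-p4 `annLeft_map_kummerOutside_eq(_places)`) and `M ≤ V` is
COISOTROPIC (`{}^⊥M ≤ M`, a product of local conditions each containing its own annihilator — «free», «Kummer», «values in a line»),
then **`#(G ⊓ M) · #G = #M · #(G ⊓ {}^⊥M)`** (§1), hence for the solution groups cut out of a global group by `loc⁻¹`: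
**`#𝒴 · #G = #M · #𝒴*`** with `𝒴*` the dual solution group (§2).  Comparing this at levels `4` and `2` (ratio `2^k`) shows that
`𝒴₄` is strictly bigger than its `2`-torsion as soon as ONE prime is free (§3, the «two-level order lemma»): an auxiliary class of order
`4` exists WITHOUT McCallum's `⌈L/2⌉` loss, so the engine runs at `L = 2` (gk2-p2 Addendum 4 had `L = 3`).

WHAT (namespace `…Theorems.GenusExact.RelaxedCount`):
* §1 `natCard_inf_mul_natCard_eq` — `#(G ⊓ M)·#G = #M·#(G ⊓ {}^⊥M)` for `G` Lagrangian, `M` coisotropic, perfect `b` (from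
  `annLeft_inf`, `natCard_annLeft_mul` and `#(G ⊔ M′)·#(G ⊓ M′) = #G·#M′`).
* §2 `natCard_eq_natCard_map_mul`, `map_inf_comap_eq`, **`natCard_solutions_mul_eq`** — the same for `𝒴 = S ⊓ loc⁻¹M`,
  `𝒴* = S ⊓ loc⁻¹({}^⊥M)`, `G = loc(S)`.
* §3 (products) `annLeft_pi_eq`, `natCard_pi_eq_prod` — `{}^⊥(Π M_i) = Π {}^⊥M_i` for the sum pairing and `#Π M_i = ∏ #M_i`.
* §4 **`exists_two_nsmul_ne_zero_of_counts`** — the two-level order lemma: `#Y₄·g₄ = m₄·#Y₄*`, `#Y₂·g₂ = m₂·#Y₂*`, `ι` injective with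
  `Y₄[2] ⊆ ι(Y₂)`, `ι(Y₂*) ⊆ Y₄*`, `m₂·g₄ < m₄·g₂` ⟹ `∃ y ∈ Y₄, 2•y ≠ 0`.
HONEST FRAMING: pure algebra with displayed hypotheses; the instantiation (`V = Π_{ℓ∈T} H¹(ℚ_ℓ, E^ε[4])`, `G = loc_T(kummerOutside T)`,
`M_ℓ = ⊤` at the free primes, `M_ℓ = res⁻¹(values in the eigen-line)` (order 8, coisotropic) at the deep own primes; `ι` = the level map
`H¹(ℚ,E[2]) → H¹(ℚ,E^ε[4])`) is the assembly's, not this file's.  Closes nothing.  BSD is NOT proved by any of this.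

References: [McCallumLMS1991] §2 Prop. 2.1 (proof: «the image … is a maximal isotropic subgroup»), §5 proof of Prop. 5.2;
[MilneADT2006] Ch. I Prop. 0.19, Thm. 4.10; Wiles 1995 Prop. 1.6 / [DDT1997] Thm. 2.19 (the Greenberg–Wiles formula, of which §1 is the
finite shadow).
-/

set_option autoImplicit false
-- `Summit.<P>.<Sub>` repeats `BirchSwinnertonDyer` by the tree's layout convention (D-0017)
set_option linter.dupNamespace false

namespace Summit.BirchSwinnertonDyer.BirchSwinnertonDyer.Theorems.GenusExact.RelaxedCount

open Function AddSubgroup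
open Summit.BirchSwinnertonDyer.Rank1Residual.X11b.FiniteDuality
open Summit.BirchSwinnertonDyer.BirchSwinnertonDyer.Theorems.SchneiderFreeAdditiveX3.PoitouTateReduction (annLeft_inf)
open Summit.BirchSwinnertonDyer.BirchSwinnertonDyer.Theorems.GenusExact.AuxiliaryClass (piSum_single)

/-! ## §1 The relaxed Lagrangian count in one ambient group -/

section OneGroup

variable {V : Type*} [AddCommGroup V] {n : ℕ}

/-- `#(H ⊔ K) · #(H ⊓ K) = #H · #K` for subgroups of a finite abelian group. [folklore] -/
theorem natCard_sup_mul_natCard_inf [Finite V] (H K : AddSubgroup V) :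
    Nat.card ↥(H ⊔ K) * Nat.card ↥(H ⊓ K) = Nat.card H * Nat.card K := by
  have h1 : Nat.card H * H.relIndex (H ⊔ K) = Nat.card ↥(H ⊔ K) := natCard_mul_relIndex_of_le le_sup_left
  have h2 : Nat.card ↥(H ⊓ K) * (H ⊓ K).relIndex K = Nat.card K := natCard_mul_relIndex_of_le inf_le_right
  rw [AddSubgroup.relIndex_sup_left] at h1
  rw [AddSubgroup.inf_relIndex_right] at h2
  calc Nat.card ↥(H ⊔ K) * Nat.card ↥(H ⊓ K)
      = Nat.card H * H.relIndex K * Nat.card ↥(H ⊓ K) := by rw [h1]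
    _ = Nat.card H * (Nat.card ↥(H ⊓ K) * H.relIndex K) := by ring
    _ = Nat.card H * Nat.card K := by rw [h2]

/-- **The relaxed Lagrangian count.**  `V` finite killed by `n` with a perfect pairing `b` (both adjoints bijective); `G ≤ V`
LAGRANGIAN (`{}^⊥G = G`); `M ≤ V` ANY subgroup (in the application coisotropic, `{}^⊥M ≤ M`, so that `G ⊓ {}^⊥M` is the DUAL
solution group).  Then **`#(G ⊓ M) · #G = #M · #(G ⊓ {}^⊥M)`**.
Proof: `{}^⊥(G ⊓ M) = G ⊔ {}^⊥M` (`annLeft_inf`), `#{}^⊥(G ⊓ M)·#(G ⊓ M) = #V = #{}^⊥M·#M` (`natCard_annLeft_mul`) and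
`#(G ⊔ {}^⊥M)·#(G ⊓ {}^⊥M) = #G·#{}^⊥M`.  (Read: `#solutions / #dual solutions = #M / #G`, i.e. Wiles' formula for the structure `M`
relative to the Lagrangian one.) [cite: MilneADT2006, Ch. I, Prop. 0.19] [cite: McCallumLMS1991, §2 proof of Prop. 2.1] -/
theorem natCard_inf_mul_natCard_eq [Finite V] [NeZero n] (hV : ∀ x : V, n • x = 0) (b : V →+ V →+ ZMod n)
    (hb : Bijective b) (hflip : Bijective b.flip) (G M : AddSubgroup V) (hG : annLeft b G = G) :
    Nat.card ↥(G ⊓ M) * Nat.card G = Nat.card M * Nat.card ↥(G ⊓ annLeft b M) := by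
  have h1 : Nat.card ↥(annLeft b (G ⊓ M)) * Nat.card ↥(G ⊓ M) = Nat.card V := natCard_annLeft_mul hV b hb (G ⊓ M)
  have h2 : annLeft b (G ⊓ M) = G ⊔ annLeft b M := by rw [annLeft_inf hV hV b hb hflip, hG]
  have h3 : Nat.card ↥(annLeft b M) * Nat.card M = Nat.card V := natCard_annLeft_mul hV b hb M
  have h4 := natCard_sup_mul_natCard_inf G (annLeft b M)
  rw [h2] at h1
  have hpos : 0 < Nat.card ↥(annLeft b M) := Nat.card_pos
  -- `#(G⊓M)·#G·#M′ = #(G⊓M)·#(G⊔M′)·#(G⊓M′) = #V·#(G⊓M′) = #M′·#M·#(G⊓M′)`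
  refine Nat.eq_of_mul_eq_mul_right hpos ?_
  calc Nat.card ↥(G ⊓ M) * Nat.card G * Nat.card ↥(annLeft b M)
      = Nat.card ↥(G ⊓ M) * (Nat.card ↥(G ⊔ annLeft b M) * Nat.card ↥(G ⊓ annLeft b M)) := by rw [h4]; ring
    _ = Nat.card V * Nat.card ↥(G ⊓ annLeft b M) := by rw [← h1]; ring
    _ = Nat.card M * Nat.card ↥(G ⊓ annLeft b M) * Nat.card ↥(annLeft b M) := by rw [← h3]; ring

end OneGroup

/-! ## §2 Solution groups cut out of a global group by a localisation map -/

section Global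

variable {W : Type*} [AddCommGroup W] {V : Type*} [AddCommGroup V] {n : ℕ}

/-- `#Y = #f(Y) · #(ker f ⊓ Y)` for a subgroup `Y` of a finite abelian group and an additive map `f`. [folklore] -/
theorem natCard_eq_natCard_map_mul [Finite W] (f : W →+ V) (Y : AddSubgroup W) :
    Nat.card Y = Nat.card ↥(Y.map f) * Nat.card ↥(f.ker ⊓ Y) := by
  set φ : Y →+ V := f.comp Y.subtype with hφ
  have hrange : φ.range = Y.map f := by rw [hφ, AddMonoidHom.range_comp, AddSubgroup.range_subtype]
  have hker : φ.ker = (f.ker ⊓ Y).addSubgroupOf Y := by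
    rw [hφ, ← AddMonoidHom.comap_ker, AddSubgroup.inf_addSubgroupOf_right]; rfl
  have h := AddSubgroup.card_mul_index φ.ker
  rw [AddSubgroup.index_ker, hrange, hker,
    Nat.card_congr (AddSubgroup.addSubgroupOfEquivOfLe (inf_le_right : f.ker ⊓ Y ≤ Y)).toEquiv] at h
  rw [← h, mul_comm]

/-- `f(S ⊓ f⁻¹M) = f(S) ⊓ M`. [folklore] -/
theorem map_inf_comap_eq (f : W →+ V) (S : AddSubgroup W) (M : AddSubgroup V) :
    (S ⊓ M.comap f).map f = S.map f ⊓ M := by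
  ext v
  constructor
  · rintro ⟨w, ⟨hwS, hwM⟩, rfl⟩
    exact ⟨⟨w, hwS, rfl⟩, hwM⟩
  · rintro ⟨⟨w, hwS, rfl⟩, hvM⟩
    exact ⟨w, ⟨hwS, hvM⟩, rfl⟩

/-- `ker f ⊓ (S ⊓ f⁻¹M) = ker f ⊓ S` (the kernel satisfies every local condition). [folklore] -/
theorem ker_inf_inf_comap_eq (f : W →+ V) (S : AddSubgroup W) (M : AddSubgroup V) :
    f.ker ⊓ (S ⊓ M.comap f) = f.ker ⊓ S := by
  ext w
  simp only [AddSubgroup.mem_inf, AddMonoidHom.mem_ker, AddSubgroup.mem_comap]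
  constructor
  · rintro ⟨h0, hS, -⟩; exact ⟨h0, hS⟩
  · rintro ⟨h0, hS⟩; exact ⟨h0, hS, by rw [h0]; exact M.zero_mem⟩

/-- **The relaxed count for solution groups.**  `loc : W →+ V` (product localisation), `S ≤ W` (the classes Kummer off `T`) with
LAGRANGIAN image `G = loc(S)` (McCallum: «the image of `H¹(K_T/K, E_m)` is a maximal isotropic subgroup of `⊕_{v∈T} H¹(K_v, E_m)`»),
`M ≤ V` coisotropic (the local conditions on `T`).  With the solution group `𝒴 := S ⊓ loc⁻¹M` and the DUAL solution group
`𝒴* := S ⊓ loc⁻¹({}^⊥M)`: **`#𝒴 · #G = #M · #𝒴*`**. [cite: McCallumLMS1991, §2 proof of Prop. 2.1] [cite: MilneADT2006, Ch. I, Thm. 4.10] -/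
theorem natCard_solutions_mul_eq [Finite W] [Finite V] [NeZero n] (hV : ∀ x : V, n • x = 0) (b : V →+ V →+ ZMod n)
    (hb : Bijective b) (hflip : Bijective b.flip) (loc : W →+ V) (S : AddSubgroup W) (M : AddSubgroup V)
    (hG : annLeft b (S.map loc) = S.map loc) :
    Nat.card ↥(S ⊓ M.comap loc) * Nat.card ↥(S.map loc) =
      Nat.card M * Nat.card ↥(S ⊓ (annLeft b M).comap loc) := by
  have hY := natCard_eq_natCard_map_mul loc (S ⊓ M.comap loc)
  have hY' := natCard_eq_natCard_map_mul loc (S ⊓ (annLeft b M).comap loc)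
  rw [map_inf_comap_eq, ker_inf_inf_comap_eq] at hY hY'
  have h := natCard_inf_mul_natCard_eq hV b hb hflip (S.map loc) M hG
  rw [hY, hY']
  calc Nat.card ↥(S.map loc ⊓ M) * Nat.card ↥(loc.ker ⊓ S) * Nat.card ↥(S.map loc)
      = Nat.card ↥(S.map loc ⊓ M) * Nat.card ↥(S.map loc) * Nat.card ↥(loc.ker ⊓ S) := by ring
    _ = Nat.card M * Nat.card ↥(S.map loc ⊓ annLeft b M) * Nat.card ↥(loc.ker ⊓ S) := by rw [h]
    _ = Nat.card M * (Nat.card ↥(S.map loc ⊓ annLeft b M) * Nat.card ↥(loc.ker ⊓ S)) := by ring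

end Global

/-! ## §3 Product local conditions under the sum pairing -/

section Product

variable {ι : Type*} [Fintype ι] [DecidableEq ι] {X : ι → Type*} [∀ i, AddCommGroup (X i)] {n : ℕ}

/-- **`{}^⊥(Π_i M_i) = Π_i {}^⊥M_i`** for the sum pairing `bP = ∑_i b_i`. [folklore] -/
theorem annLeft_pi_eq (b : ∀ i, X i →+ X i →+ ZMod n) (bP : (∀ i, X i) →+ (∀ i, X i) →+ ZMod n)
    (hbP : ∀ x y, bP x y = ∑ i, b i (x i) (y i)) (M : ∀ i, AddSubgroup (X i)) :
    annLeft bP (AddSubgroup.pi Set.univ M) = AddSubgroup.pi Set.univ (fun i ↦ annLeft (b i) (M i)) := by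
  ext x
  rw [mem_annLeft_iff, AddSubgroup.mem_pi]
  constructor
  · intro hx i _
    rw [mem_annLeft_iff]
    intro m hm
    rw [← piSum_single b bP hbP x i m]
    refine hx _ ((AddSubgroup.mem_pi _).mpr fun j _ ↦ ?_)
    by_cases hji : j = i
    · subst hji; rw [Pi.single_eq_same]; exact hm
    · rw [Pi.single_eq_of_ne hji]; exact (M j).zero_mem
  · intro hx y hy
    rw [hbP]
    refine Finset.sum_eq_zero fun i _ ↦ ?_
    exact (mem_annLeft_iff _ _ _).mp (hx i (Set.mem_univ i)) (y i) ((AddSubgroup.mem_pi _).mp hy i (Set.mem_univ i))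

omit [Fintype ι] [DecidableEq ι] in
/-- `#(Π_i M_i) = ∏_i #M_i` (for a `Fintype` index). [folklore] -/
theorem natCard_pi_eq_prod [Fintype ι] (M : ∀ i, AddSubgroup (X i)) :
    Nat.card ↥(AddSubgroup.pi Set.univ M) = ∏ i, Nat.card (M i) := by
  rw [← Nat.card_pi]
  refine Nat.card_congr ⟨fun x i ↦ ⟨x.1 i, (AddSubgroup.mem_pi _).mp x.2 i (Set.mem_univ i)⟩,
    fun y ↦ ⟨fun i ↦ (y i).1, (AddSubgroup.mem_pi _).mpr fun i _ ↦ (y i).2⟩, fun x ↦ rfl, fun y ↦ rfl⟩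

/-- A product of coisotropic conditions is coisotropic for the sum pairing. [folklore] -/
theorem annLeft_pi_le (b : ∀ i, X i →+ X i →+ ZMod n) (bP : (∀ i, X i) →+ (∀ i, X i) →+ ZMod n)
    (hbP : ∀ x y, bP x y = ∑ i, b i (x i) (y i)) (M : ∀ i, AddSubgroup (X i))
    (hM : ∀ i, annLeft (b i) (M i) ≤ M i) :
    annLeft bP (AddSubgroup.pi Set.univ M) ≤ AddSubgroup.pi Set.univ M := by
  rw [annLeft_pi_eq b bP hbP]
  intro x hx
  exact (AddSubgroup.mem_pi _).mpr fun i hi ↦ hM i ((AddSubgroup.mem_pi _).mp hx i hi)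

/-- **The relaxed count on a finite product** (the shape used by the bottom-rung engine): `X_i` finite killed by `n` with perfect
`b_i`, `bP = ∑ b_i`, `G = loc(S)` Lagrangian in `Π_i X_i`, local conditions `M_i` (coisotropic in the application).  Then
**`#(S ⊓ loc⁻¹ Π M_i) · #G = (∏_i #M_i) · #(S ⊓ loc⁻¹ Π {}^⊥M_i)`**.  With `M_i = ⊤` at the free indices (`{}^⊥⊤ = 0`) and
`#G² = ∏_i #X_i` (gk2-p4 `natCard_map_kummerOutside_sq`) this is `#𝒴² = ∏_{free} #X_i · ∏_{rest} (#M_i/#{}^⊥M_i) · #𝒴*²`.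
[cite: McCallumLMS1991, §2 proof of Prop. 2.1] [cite: MilneADT2006, Ch. I, Thm. 4.10] -/
theorem natCard_solutions_mul_eq_pi {W : Type*} [AddCommGroup W] [Finite W] [∀ i, Finite (X i)] [NeZero n]
    (hX : ∀ i (x : X i), n • x = 0) (b : ∀ i, X i →+ X i →+ ZMod n) (hb : ∀ i, Injective (b i))
    (hbflip : ∀ i, Injective (b i).flip) (bP : (∀ i, X i) →+ (∀ i, X i) →+ ZMod n)
    (hbP : ∀ x y, bP x y = ∑ i, b i (x i) (y i)) (loc : W →+ ∀ i, X i) (S : AddSubgroup W)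
    (hG : annLeft bP (S.map loc) = S.map loc) (M : ∀ i, AddSubgroup (X i)) :
    Nat.card ↥(S ⊓ (AddSubgroup.pi Set.univ M).comap loc) * Nat.card ↥(S.map loc) =
      (∏ i, Nat.card (M i)) *
        Nat.card ↥(S ⊓ (AddSubgroup.pi Set.univ (fun i ↦ annLeft (b i) (M i))).comap loc) := by
  haveI : Finite (∀ i, X i) := Pi.finite
  have hV : ∀ x : (∀ i, X i), n • x = 0 := fun x ↦ funext fun i ↦ by
    rw [Pi.smul_apply, Pi.zero_apply, hX i (x i)]
  have hbPb : Bijective bP := AuxiliaryClass.bijective_piSum hX b hb bP hbP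
  have hbPflip : ∀ x y, bP.flip x y = ∑ i, (b i).flip (x i) (y i) := fun x y ↦ by
    rw [AddMonoidHom.flip_apply, hbP]
    exact Finset.sum_congr rfl fun i _ ↦ (AddMonoidHom.flip_apply _ _ _).symm
  have hbPf : Bijective bP.flip := AuxiliaryClass.bijective_piSum hX (fun i ↦ (b i).flip) hbflip bP.flip hbPflip
  have h := natCard_solutions_mul_eq hV bP hbPb hbPf loc S (AddSubgroup.pi Set.univ M) hG
  rw [annLeft_pi_eq b bP hbP, natCard_pi_eq_prod] at h
  exact h

end Product

/-! ## §4 The two-level order lemma -/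

section TwoLevel

variable {W₂ : Type*} [AddCommGroup W₂] {W₄ : Type*} [AddCommGroup W₄]

/-- **Two-level order lemma.**  `ι : W₂ →+ W₄` injective (the level map `H¹(E[2]) → H¹(E[4])`); solution groups `Y₄, Y₄* ≤ W₄`,
`Y₂, Y₂* ≤ W₂` with the relaxed counts `#Y₄·g₄ = m₄·#Y₄*`, `#Y₂·g₂ = m₂·#Y₂*`; the `2`-torsion of `Y₄` comes from `Y₂`
(`y ∈ Y₄, 2•y = 0 ⟹ y ∈ ι(Y₂)`) and `ι(Y₂*) ⊆ Y₄*`; and the level-`4` ratio beats the level-`2` one: `m₂·g₄ < m₄·g₂`.  Then **`Y₄`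
contains an element `y` with `2•y ≠ 0`** (an auxiliary class of order `4`).  In the bottom-rung engine `m₄/g₄ = 4^k·2^{|t|}`,
`m₂/g₂ = 2^{k+|t|}`, ratio `2^k > 1` for `k ≥ 1` free primes. [cite: McCallumLMS1991, §5 proof of Prop. 5.2] -/
theorem exists_two_nsmul_ne_zero_of_counts [Finite W₂] [Finite W₄] (ι : W₂ →+ W₄) (hι : Injective ι)
    (Y₄ Y₄' : AddSubgroup W₄) (Y₂ Y₂' : AddSubgroup W₂) {g₂ g₄ m₂ m₄ : ℕ}
    (h4 : Nat.card Y₄ * g₄ = m₄ * Nat.card Y₄') (h2 : Nat.card Y₂ * g₂ = m₂ * Nat.card Y₂')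
    (htors : ∀ y ∈ Y₄, 2 • y = 0 → y ∈ Y₂.map ι) (hdual : Y₂'.map ι ≤ Y₄')
    (hlt : m₂ * g₄ < m₄ * g₂) :
    ∃ y ∈ Y₄, 2 • y ≠ 0 := by
  by_contra hne
  push Not at hne
  -- `Y₄ ≤ ι(Y₂)` and `ι(Y₂*) ≤ Y₄*`
  have hle : Nat.card Y₄ ≤ Nat.card Y₂ := by
    calc Nat.card Y₄ ≤ Nat.card ↥(Y₂.map ι) :=
          AddSubgroup.card_le_of_le fun y hy ↦ htors y hy (hne y hy)
      _ ≤ Nat.card Y₂ := Nat.card_le_card_of_surjective _ (AddMonoidHom.addSubgroupMap_surjective ι Y₂)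
  have hle' : Nat.card Y₂' ≤ Nat.card Y₄' := by
    calc Nat.card Y₂' = Nat.card ↥(Y₂'.map ι) :=
          (Nat.card_congr (Y₂'.equivMapOfInjective ι hι).toEquiv)
      _ ≤ Nat.card Y₄' := AddSubgroup.card_le_of_le hdual
  have hpos : 0 < Nat.card Y₄' := Nat.card_pos
  -- `#Y₄·g₄·g₂ = m₄·g₂·#Y₄* > m₂·g₄·#Y₄* ≥ m₂·g₄·#Y₂* = #Y₂·g₂·g₄ ≥ #Y₄·g₄·g₂`
  have key : Nat.card Y₄ * g₄ * g₂ < Nat.card Y₄ * g₄ * g₂ := by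
    calc Nat.card Y₄ * g₄ * g₂ ≤ Nat.card Y₂ * g₂ * g₄ := by
          rw [mul_right_comm]; exact Nat.mul_le_mul_right _ (Nat.mul_le_mul_right _ hle)
      _ = m₂ * g₄ * Nat.card Y₂' := by rw [h2]; ring
      _ ≤ m₂ * g₄ * Nat.card Y₄' := Nat.mul_le_mul_left _ hle'
      _ < m₄ * g₂ * Nat.card Y₄' := Nat.mul_lt_mul_of_pos_right hlt hpos
      _ = Nat.card Y₄ * g₄ * g₂ := by rw [mul_right_comm, ← h4]
  exact lt_irrefl _ key

end TwoLevel

/-! ## §5 The same without finiteness of the GLOBAL group (appendix, g16: the global group of the application is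
`H¹(K, E[n])`, which is infinite — only `kummerOutside T`, the local groups and the solution groups are finite) -/

section GlobalInfinite

variable {W : Type*} [AddCommGroup W] {V : Type*} [AddCommGroup V] {n : ℕ}

/-- `#Y = #f(Y) · #(ker f ⊓ Y)` for a subgroup `Y` of ANY abelian group (`Nat.card`; no finiteness needed). [folklore] -/
theorem natCard_eq_natCard_map_mul' (f : W →+ V) (Y : AddSubgroup W) :
    Nat.card Y = Nat.card ↥(Y.map f) * Nat.card ↥(f.ker ⊓ Y) := by
  set φ : Y →+ V := f.comp Y.subtype with hφ
  have hrange : φ.range = Y.map f := by rw [hφ, AddMonoidHom.range_comp, AddSubgroup.range_subtype]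
  have hker : φ.ker = (f.ker ⊓ Y).addSubgroupOf Y := by
    rw [hφ, ← AddMonoidHom.comap_ker, AddSubgroup.inf_addSubgroupOf_right]; rfl
  have h := AddSubgroup.card_mul_index φ.ker
  rw [AddSubgroup.index_ker, hrange, hker,
    Nat.card_congr (AddSubgroup.addSubgroupOfEquivOfLe (inf_le_right : f.ker ⊓ Y ≤ Y)).toEquiv] at h
  rw [← h, mul_comm]

/-- **The relaxed count for solution groups, global group arbitrary** (`V` finite with a perfect pairing; `G = loc(S)` Lagrangian;
`M ≤ V` any local condition, coisotropic in the application): **`#(S ⊓ loc⁻¹M) · #G = #M · #(S ⊓ loc⁻¹{}^⊥M)`**.  This is the form the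
assembly uses (`W = H¹(K, E[p^k])`, `S = kummerOutside T`). [cite: McCallumLMS1991, §2 proof of Prop. 2.1] [cite: MilneADT2006, Ch. I, Thm. 4.10] -/
theorem natCard_solutions_mul_eq' [Finite V] [NeZero n] (hV : ∀ x : V, n • x = 0) (b : V →+ V →+ ZMod n)
    (hb : Bijective b) (hflip : Bijective b.flip) (loc : W →+ V) (S : AddSubgroup W) (M : AddSubgroup V)
    (hG : annLeft b (S.map loc) = S.map loc) :
    Nat.card ↥(S ⊓ M.comap loc) * Nat.card ↥(S.map loc) =
      Nat.card M * Nat.card ↥(S ⊓ (annLeft b M).comap loc) := by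
  have hY := natCard_eq_natCard_map_mul' loc (S ⊓ M.comap loc)
  have hY' := natCard_eq_natCard_map_mul' loc (S ⊓ (annLeft b M).comap loc)
  rw [map_inf_comap_eq, ker_inf_inf_comap_eq] at hY hY'
  have h := natCard_inf_mul_natCard_eq hV b hb hflip (S.map loc) M hG
  rw [hY, hY']
  calc Nat.card ↥(S.map loc ⊓ M) * Nat.card ↥(loc.ker ⊓ S) * Nat.card ↥(S.map loc)
      = Nat.card ↥(S.map loc ⊓ M) * Nat.card ↥(S.map loc) * Nat.card ↥(loc.ker ⊓ S) := by ring
    _ = Nat.card M * Nat.card ↥(S.map loc ⊓ annLeft b M) * Nat.card ↥(loc.ker ⊓ S) := by rw [h]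
    _ = Nat.card M * (Nat.card ↥(S.map loc ⊓ annLeft b M) * Nat.card ↥(loc.ker ⊓ S)) := by ring

end GlobalInfinite

section ProductInfinite

variable {ι : Type*} [Fintype ι] [DecidableEq ι] {X : ι → Type*} [∀ i, AddCommGroup (X i)] {n : ℕ}

/-- **The relaxed count on a finite product, global group arbitrary**:
`#(S ⊓ loc⁻¹ Π M_i) · #loc(S) = (∏_i #M_i) · #(S ⊓ loc⁻¹ Π {}^⊥M_i)`. [cite: McCallumLMS1991, §2 proof of Prop. 2.1]
[cite: MilneADT2006, Ch. I, Thm. 4.10] -/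
theorem natCard_solutions_mul_eq_pi' {W : Type*} [AddCommGroup W] [∀ i, Finite (X i)] [NeZero n]
    (hX : ∀ i (x : X i), n • x = 0) (b : ∀ i, X i →+ X i →+ ZMod n) (hb : ∀ i, Injective (b i))
    (hbflip : ∀ i, Injective (b i).flip) (bP : (∀ i, X i) →+ (∀ i, X i) →+ ZMod n)
    (hbP : ∀ x y, bP x y = ∑ i, b i (x i) (y i)) (loc : W →+ ∀ i, X i) (S : AddSubgroup W)
    (hG : annLeft bP (S.map loc) = S.map loc) (M : ∀ i, AddSubgroup (X i)) :
    Nat.card ↥(S ⊓ (AddSubgroup.pi Set.univ M).comap loc) * Nat.card ↥(S.map loc) =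
      (∏ i, Nat.card (M i)) *
        Nat.card ↥(S ⊓ (AddSubgroup.pi Set.univ (fun i ↦ annLeft (b i) (M i))).comap loc) := by
  haveI : Finite (∀ i, X i) := Pi.finite
  have hV : ∀ x : (∀ i, X i), n • x = 0 := fun x ↦ funext fun i ↦ by
    rw [Pi.smul_apply, Pi.zero_apply, hX i (x i)]
  have hbPb : Bijective bP := AuxiliaryClass.bijective_piSum hX b hb bP hbP
  have hbPflip : ∀ x y, bP.flip x y = ∑ i, (b i).flip (x i) (y i) := fun x y ↦ by
    rw [AddMonoidHom.flip_apply, hbP]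
    exact Finset.sum_congr rfl fun i _ ↦ (AddMonoidHom.flip_apply _ _ _).symm
  have hbPf : Bijective bP.flip := AuxiliaryClass.bijective_piSum hX (fun i ↦ (b i).flip) hbflip bP.flip hbPflip
  have h := natCard_solutions_mul_eq' hV bP hbPb hbPf loc S (AddSubgroup.pi Set.univ M) hG
  rw [annLeft_pi_eq b bP hbP, natCard_pi_eq_prod] at h
  exact h

end ProductInfinite

section TwoLevelInfinite

variable {W₂ : Type*} [AddCommGroup W₂] {W₄ : Type*} [AddCommGroup W₄]

/-- **Two-level order lemma, global groups arbitrary** (only `Y₂` and `Y₄*` finite — the solution groups are, the ambient `H¹` are not):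
`#Y₄·g₄ = m₄·#Y₄*`, `#Y₂·g₂ = m₂·#Y₂*`, `Y₄[2] ⊆ ι(Y₂)`, `ι(Y₂*) ⊆ Y₄*`, `m₂·g₄ < m₄·g₂` ⟹ `∃ y ∈ Y₄, 2•y ≠ 0`.
[cite: McCallumLMS1991, §5 proof of Prop. 5.2] -/
theorem exists_two_nsmul_ne_zero_of_counts' (ι : W₂ →+ W₄) (hι : Injective ι)
    (Y₄ Y₄' : AddSubgroup W₄) (Y₂ Y₂' : AddSubgroup W₂) [Finite Y₂] [Finite Y₄'] {g₂ g₄ m₂ m₄ : ℕ}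
    (h4 : Nat.card Y₄ * g₄ = m₄ * Nat.card Y₄') (h2 : Nat.card Y₂ * g₂ = m₂ * Nat.card Y₂')
    (htors : ∀ y ∈ Y₄, 2 • y = 0 → y ∈ Y₂.map ι) (hdual : Y₂'.map ι ≤ Y₄')
    (hlt : m₂ * g₄ < m₄ * g₂) :
    ∃ y ∈ Y₄, 2 • y ≠ 0 := by
  by_contra hne
  push Not at hne
  haveI : Finite ↥(Y₂.map ι) := Finite.of_surjective _ (AddMonoidHom.addSubgroupMap_surjective ι Y₂)
  have hle : Nat.card Y₄ ≤ Nat.card Y₂ := by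
    calc Nat.card Y₄ ≤ Nat.card ↥(Y₂.map ι) :=
          AddSubgroup.card_le_of_le fun y hy ↦ htors y hy (hne y hy)
      _ ≤ Nat.card Y₂ := Nat.card_le_card_of_surjective _ (AddMonoidHom.addSubgroupMap_surjective ι Y₂)
  have hle' : Nat.card Y₂' ≤ Nat.card Y₄' := by
    calc Nat.card Y₂' = Nat.card ↥(Y₂'.map ι) :=
          (Nat.card_congr (Y₂'.equivMapOfInjective ι hι).toEquiv)
      _ ≤ Nat.card Y₄' := AddSubgroup.card_le_of_le hdual
  have hpos : 0 < Nat.card Y₄' := Nat.card_pos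
  have key : Nat.card Y₄ * g₄ * g₂ < Nat.card Y₄ * g₄ * g₂ := by
    calc Nat.card Y₄ * g₄ * g₂ ≤ Nat.card Y₂ * g₂ * g₄ := by
          rw [mul_right_comm]; exact Nat.mul_le_mul_right _ (Nat.mul_le_mul_right _ hle)
      _ = m₂ * g₄ * Nat.card Y₂' := by rw [h2]; ring
      _ ≤ m₂ * g₄ * Nat.card Y₄' := Nat.mul_le_mul_left _ hle'
      _ < m₄ * g₂ * Nat.card Y₄' := Nat.mul_lt_mul_of_pos_right hlt hpos
      _ = Nat.card Y₄ * g₄ * g₂ := by rw [mul_right_comm, ← h4]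
  exact lt_irrefl _ key

end TwoLevelInfinite

end Summit.BirchSwinnertonDyer.BirchSwinnertonDyer.Theorems.GenusExact.RelaxedCount
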